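/-
Copyright (c) 2026 the pub-hodgecm-mathlib formalisation cell (harness21).  Prover seat hodgecm-mathlib-LH10-p02 (g14), 2026-09-03.  E1 row 68-L «A SMOOTH VECTOR IS FIXED BY SOME
LEVEL GROUP» (keeper ∕ dealer F0P3a-p03 (g31) k23; consumers: 68-I, rows 58 ∕ 59 §2, row 72 — the `(he : ∃ x₀, r.ρ.fixedPoints (U x₀) ≠ ⊥)` binder of the K1∕K2′∕K4′ assembly heads).
-/
import Summits.HodgeConjecture.HodgeConjecture.Theorems.F0P3cStCharTSCharacterEllipticUniform   -- ★ 41g-H: the datum letters `(L v w hw ϖ eA)`, the level-family shape `hU`, its SUPPLIER `exists_actionHom_unitaryLevelFamily`; brings ★ row 43, ★ `compactSpace_integer_adicCompletion`, `SmoothIrrep`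
import HarnessLib

/-!
# F0 · P3c · E1 row 68-L — A SMOOTH VECTOR OF `U(3)(L⁺_v)` IS FIXED BY A LEVEL GROUP `U^{(e)}_{x₀}` AT EVERY VERTEX `x₀`, FOR ALL LARGE `e`
# (Bernstein–Zelevinsky 1976 §2.1; Schneider–Stuhler 1997 Ch. I §2 (U1)–(U2): the `U^{(e)}_x` are a neighbourhood basis of `1`)

Cell `pub/hodgecm-mathlib`, crux H413 = `stmt-HodgeConjecture-24833` (`--supports` lane, helper, THEOREMS ONLY: no definition ∕ instance ∕ notation ∕ named fact ∕ `sorry`; count-neutral).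
Namespace `Summit.HodgeConjecture.HodgeConjecture.Cruxes.H413.F0P3cStCharTSLevelFixedVector`.  E1 BRICK LEDGER row 68-L (keeper F0P3a-p03 (g31) k23): the level-choice input
`(he : ∃ x₀, r.ρ.fixedPoints (U x₀) ≠ ⊥)` of the trunk heads (★ row 59 `F0P3cStCharTSEPNormOneUnr`, row 58 S2a, 68-I, row 72), DISCHARGED for every irreducible smooth `r` of
`Gqs L v` in the TRUNK's letter shape `{e} {U} (hU : ∀ x g, g ∈ U x ↔ g·x = x ∧ (g − 1)·x ⊆ ϖ^(e+1)·x)` (read through the one-place model `eA : Gqs L v ≃ₜ* U(Φ₃)(L_w)`).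
MATHEMATICS.  A smooth vector `v₀` has OPEN stabiliser `S ≤ Gqs L v`; `eA(S)` is open in `U(Φ₃)(L_w) ≤ GL₃(L_w)`, i.e. the trace of an open `W ∋ 1` of `GL₃(L_w)`; by ★ row 43
`exists_forall_map_sub_one_latt_le_scaleLattice_pow_imp_mem` (the pure level sets `{γ : (γ − 1)·latt g₀ ⊆ ϖ^e·latt g₀}` shrink to `1`, `𝒪_w` compact ★ `compactSpace_integer_adicCompletion`)
some level `e₀` at the lattice `x₀ = latt g₀` puts the whole level set inside `W`, hence `U^{(e)}_{x₀} ≤ S` for every `e ≥ e₀` (★ row 22 `map_sub_one_le_scaleLattice_pow_of_le`), i.e.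
`v₀ ∈ V^{U^{(e)}_{x₀}}`; an irreducible representation has a non-zero vector, so `V^{U^{(e)}_{x₀}} ≠ ⊥`.  The statements are PLACE-FREE in `ϖ` (`ϖ ≠ 0`, `|ϖ| < 1`); the `_of_datum`
form takes the trunk's `hd : UnramifiedLocalConjDatum σ_w ϖ` and the `_of_v` form the TAME road's `hϖ : |ϖ| = q⁻¹` instead.  HONEST LABEL: count-neutral datum helper; E1 = PRINT; HC_CM is
proved only modulo the 7 printed citations (2 remaining named inputs hLiu418 = `stmt-HodgeConjecture-24832`, h413 = `stmt-HodgeConjecture-24833`) until rung 0 closes.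

* §1 `exists_forall_mem_fixedPoints_of_isSmoothVector` (any coefficient ring `k`, any representation, any smooth vector, any vertex: `∃ e₀, ∀ e ≥ e₀, ∀ U, hU → v₀ ∈ V^{U x₀}`).
* §2 **`exists_level_fixedPoints_ne_bot (r : SmoothIrrep (Gqs L v)) (x₀) : ∃ e₀, ∀ e ≥ e₀, ∀ U, hU → r.ρ.fixedPoints (U x₀) ≠ ⊥`**, and the by-name forms
  `…_of_datum (hd : UnramifiedLocalConjDatum σ_w ϖ)` (trunk letters) ∕ `…_of_v (hϖ : Valued.v ϖ = exp (−1))` (tame letters).  Consumers: `obtain ⟨e₀, he⟩ := …; obtain ⟨a, U, ha, hU⟩ :=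
  exists_actionHom_unitaryLevelFamily L v w hw eA e₀` (★ 41g-H), then `he le_rfl hU : r.ρ.fixedPoints (U x₀) ≠ ⊥`.

## References
* [BernsteinZelevinsky1976] I. N. Bernstein, A. V. Zelevinsky, *Representations of the group GL(n,F) where F is a non-archimedean local field*, Russian Math. Surveys 31:3 (1976), §2.1.
* [SchneiderStuhler1997] P. Schneider, U. Stuhler, *Representation theory and sheaves on the Bruhat–Tits building*, Publ. Math. IHÉS 85 (1997), Ch. I §2 (U1)–(U2).
* [BushnellHenniart2006] C. J. Bushnell, G. Henniart, *The Local Langlands Conjecture for GL(2)*, Grundlehren 335 (2006), §1.1 (smooth representations; an irreducible representation is non-zero).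
-/

set_option autoImplicit false
-- the mandated namespace has the single-problem summit's repeated segment (`HodgeConjecture.HodgeConjecture`)
set_option linter.dupNamespace false

noncomputable section

open NumberField IsDedekindDomain Topology
open scoped Valued WithZero
open Literature.NumberTheory.Rogawski1990 Literature.NumberTheory.Rogawski1990.Ch12Sec5
open Literature.NumberTheory.Automorphic Literature.NumberTheory.Automorphic.UnitaryGroup Literature.NumberTheory.Automorphic.UnitaryLatticeTree
open Literature.NumberTheory.Automorphic.HermitianLattice

namespace Summit.HodgeConjecture.HodgeConjecture.Cruxes.H413.F0P3cStCharTSLevelFixedVector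

variable (L : Type) [Field L] [NumberField L] [IsCMField L] (v : HeightOneSpectrum (𝓞 ↥(maximalRealSubfield L)))
  (w : PlacesOver L v) (hw : IsCMField.complexConj L • w.1 = w.1) {ϖ : w.1.adicCompletion L}
  (eA : Gqs L v ≃ₜ* ↥(unitaryGroupOfForm (galAdicCompletionMap (L := L) (IsCMField.complexConj L) hw) ((StdForm.antidiagonal 3).over (w.1.adicCompletion L))))

/-! ## §1 A smooth vector is fixed by `U^{(e)}_{x₀}` for all large `e`, at every vertex `x₀` -/

/-- **A SMOOTH VECTOR IS FIXED BY A LEVEL GROUP AT EVERY VERTEX, FOR ALL LARGE LEVELS**: if `v₀` has open stabiliser in `Gqs L v`, then for every vertex `x₀` of the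
`U(Φ₃)(L_w)`-tree there is `e₀` such that every level family `U` of level `ϖ^(e+1)`, `e ≥ e₀` (in the trunk's `hU` letter shape, read through `eA`) has `v₀ ∈ V^{U x₀}`.
(The `U^{(e)}_{x₀}` are a neighbourhood basis of `1` — ★ row 43 — and `𝒪_w` is compact.) [cite: BernsteinZelevinsky1976, §2.1] [cite: SchneiderStuhler1997, Ch. I §2] -/
theorem exists_forall_mem_fixedPoints_of_isSmoothVector (hϖ0 : ϖ ≠ 0) (hϖ1 : Valued.v ϖ < 1)
    {k V : Type*} [CommRing k] [AddCommGroup V] [Module k V] (ρ : Representation k (Gqs L v) V) {v₀ : V} (hv₀ : ρ.IsSmoothVector v₀)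
    (x₀ : {M : Submodule 𝒪[(w.1.adicCompletion L)] (Fin 3 → (w.1.adicCompletion L)) // IsVertex (galAdicCompletionMap (L := L) (IsCMField.complexConj L) hw) ϖ ((StdForm.antidiagonal 3).over (w.1.adicCompletion L)) M}) :
    ∃ e₀ : ℕ, ∀ ⦃e : ℕ⦄, e₀ ≤ e → ∀ ⦃U : {M : Submodule 𝒪[(w.1.adicCompletion L)] (Fin 3 → (w.1.adicCompletion L)) // IsVertex (galAdicCompletionMap (L := L) (IsCMField.complexConj L) hw) ϖ ((StdForm.antidiagonal 3).over (w.1.adicCompletion L)) M} → Subgroup (Gqs L v)⦄,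
      (∀ x g, g ∈ U x ↔ mapGL ((eA g : ↥(unitaryGroupOfForm (galAdicCompletionMap (L := L) (IsCMField.complexConj L) hw) ((StdForm.antidiagonal 3).over (w.1.adicCompletion L)))) : GL (Fin 3) (w.1.adicCompletion L)) x.1 = x.1 ∧
        x.1.map ((Matrix.toLin' ((((eA g : ↥(unitaryGroupOfForm (galAdicCompletionMap (L := L) (IsCMField.complexConj L) hw) ((StdForm.antidiagonal 3).over (w.1.adicCompletion L)))) : GL (Fin 3) (w.1.adicCompletion L)) : Matrix (Fin 3) (Fin 3) (w.1.adicCompletion L)) - 1)).restrictScalars 𝒪[(w.1.adicCompletion L)]) ≤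
          scaleLattice (ϖ ^ (e + 1)) x.1) →
      v₀ ∈ ρ.fixedPoints (U x₀) := by
  haveI : CompactSpace 𝒪[(w.1.adicCompletion L)] := compactSpace_integer_adicCompletion L w.1
  -- the vertex is `latt g₀`
  obtain ⟨d, g₀, hx₀, -, -, -⟩ := x₀.2
  -- the open stabiliser, pushed to `U(Φ₃)(L_w)` and written as the trace of an open `t ∋ 1` of `GL₃(L_w)`
  have hS : IsOpen ((eA : Gqs L v → ↥(unitaryGroupOfForm (galAdicCompletionMap (L := L) (IsCMField.complexConj L) hw) ((StdForm.antidiagonal 3).over (w.1.adicCompletion L)))) '' (ρ.stabilizerSubgroup v₀ : Set (Gqs L v))) :=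
    eA.toHomeomorph.isOpenMap _ hv₀
  obtain ⟨t, hto, ht⟩ := isOpen_induced_iff.1 hS
  have h1t : (1 : GL (Fin 3) (w.1.adicCompletion L)) ∈ t := by
    have h1 : (1 : ↥(unitaryGroupOfForm (galAdicCompletionMap (L := L) (IsCMField.complexConj L) hw) ((StdForm.antidiagonal 3).over (w.1.adicCompletion L)))) ∈ Subtype.val ⁻¹' t := by
      rw [ht]; exact ⟨1, Subgroup.one_mem _, map_one eA⟩
    simpa using h1
  obtain ⟨e₀, -, hW⟩ := exists_forall_map_sub_one_latt_le_scaleLattice_pow_imp_mem hϖ0 hϖ1 g₀ hto h1t 0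
  refine ⟨e₀, fun e hee U hU => ?_⟩
  rw [Representation.mem_fixedPoints]
  intro g hg
  have hg' := ((hU x₀ g).1 hg).2
  rw [hx₀] at hg'
  have hmem : ((eA g : ↥(unitaryGroupOfForm (galAdicCompletionMap (L := L) (IsCMField.complexConj L) hw) ((StdForm.antidiagonal 3).over (w.1.adicCompletion L)))) : GL (Fin 3) (w.1.adicCompletion L)) ∈ t :=
    hW _ (map_sub_one_le_scaleLattice_pow_of_le hϖ1.le (Nat.le_succ_of_le hee) hg')
  have hmem' : eA g ∈ (eA : Gqs L v → ↥(unitaryGroupOfForm (galAdicCompletionMap (L := L) (IsCMField.complexConj L) hw) ((StdForm.antidiagonal 3).over (w.1.adicCompletion L)))) '' (ρ.stabilizerSubgroup v₀ : Set (Gqs L v)) := by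
    rw [← ht]; exact hmem
  obtain ⟨g', hg'S, hgg'⟩ := hmem'
  obtain rfl : g' = g := eA.injective hgg'
  exact hg'S

/-! ## §2 An irreducible smooth representation has a non-zero `U^{(e)}_{x₀}`-fixed vector (the trunk's `he` binder) -/

/-- **THE TRUNK's `he` BINDER, DISCHARGED**: for an irreducible smooth `r` of `Gqs L v` and ANY vertex `x₀`, `r.ρ.fixedPoints (U x₀) ≠ ⊥` for every level family `U` of
level `ϖ^(e+1)` with `e ≥ e₀(r, x₀)` — an irreducible representation has a non-zero (smooth) vector, fixed by `U^{(e)}_{x₀}` for large `e` (§1).  Place-free letters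
`ϖ ≠ 0`, `|ϖ| < 1`. [cite: BernsteinZelevinsky1976, §2.1] [cite: SchneiderStuhler1997, Ch. I §2] [cite: BushnellHenniart2006, §1.1] -/
theorem exists_level_fixedPoints_ne_bot (hϖ0 : ϖ ≠ 0) (hϖ1 : Valued.v ϖ < 1) (r : SmoothIrrep (Gqs L v))
    (x₀ : {M : Submodule 𝒪[(w.1.adicCompletion L)] (Fin 3 → (w.1.adicCompletion L)) // IsVertex (galAdicCompletionMap (L := L) (IsCMField.complexConj L) hw) ϖ ((StdForm.antidiagonal 3).over (w.1.adicCompletion L)) M}) :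
    ∃ e₀ : ℕ, ∀ ⦃e : ℕ⦄, e₀ ≤ e → ∀ ⦃U : {M : Submodule 𝒪[(w.1.adicCompletion L)] (Fin 3 → (w.1.adicCompletion L)) // IsVertex (galAdicCompletionMap (L := L) (IsCMField.complexConj L) hw) ϖ ((StdForm.antidiagonal 3).over (w.1.adicCompletion L)) M} → Subgroup (Gqs L v)⦄,
      (∀ x g, g ∈ U x ↔ mapGL ((eA g : ↥(unitaryGroupOfForm (galAdicCompletionMap (L := L) (IsCMField.complexConj L) hw) ((StdForm.antidiagonal 3).over (w.1.adicCompletion L)))) : GL (Fin 3) (w.1.adicCompletion L)) x.1 = x.1 ∧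
        x.1.map ((Matrix.toLin' ((((eA g : ↥(unitaryGroupOfForm (galAdicCompletionMap (L := L) (IsCMField.complexConj L) hw) ((StdForm.antidiagonal 3).over (w.1.adicCompletion L)))) : GL (Fin 3) (w.1.adicCompletion L)) : Matrix (Fin 3) (Fin 3) (w.1.adicCompletion L)) - 1)).restrictScalars 𝒪[(w.1.adicCompletion L)]) ≤
          scaleLattice (ϖ ^ (e + 1)) x.1) →
      r.ρ.fixedPoints (U x₀) ≠ ⊥ := by
  -- an irreducible representation is non-zero
  have hne : (⊥ : Subrepresentation r.ρ) ≠ ⊤ := bot_ne_top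
  have hne' : (⊥ : Submodule ℂ r.V) ≠ ⊤ := fun h => hne (Subrepresentation.toSubmodule_injective h)
  haveI : Nontrivial r.V := (Submodule.nontrivial_iff ℂ).mp (nontrivial_of_ne _ _ hne')
  obtain ⟨v₀, hv₀⟩ := exists_ne (0 : r.V)
  obtain ⟨e₀, h⟩ := exists_forall_mem_fixedPoints_of_isSmoothVector L v w hw eA hϖ0 hϖ1 r.ρ (r.isSmooth v₀) x₀
  exact ⟨e₀, fun e hee U hU => (Submodule.ne_bot_iff _).2 ⟨v₀, h hee hU, hv₀⟩⟩

/-- The same in the TRUNK's letters (`hd : UnramifiedLocalConjDatum σ_w ϖ`, unramified `v`). [cite: BernsteinZelevinsky1976, §2.1] [cite: SchneiderStuhler1997, Ch. I §2] -/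
theorem exists_level_fixedPoints_ne_bot_of_datum (hd : UnramifiedLocalConjDatum (galAdicCompletionMap (L := L) (IsCMField.complexConj L) hw) ϖ) (r : SmoothIrrep (Gqs L v))
    (x₀ : {M : Submodule 𝒪[(w.1.adicCompletion L)] (Fin 3 → (w.1.adicCompletion L)) // IsVertex (galAdicCompletionMap (L := L) (IsCMField.complexConj L) hw) ϖ ((StdForm.antidiagonal 3).over (w.1.adicCompletion L)) M}) :
    ∃ e₀ : ℕ, ∀ ⦃e : ℕ⦄, e₀ ≤ e → ∀ ⦃U : {M : Submodule 𝒪[(w.1.adicCompletion L)] (Fin 3 → (w.1.adicCompletion L)) // IsVertex (galAdicCompletionMap (L := L) (IsCMField.complexConj L) hw) ϖ ((StdForm.antidiagonal 3).over (w.1.adicCompletion L)) M} → Subgroup (Gqs L v)⦄,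
      (∀ x g, g ∈ U x ↔ mapGL ((eA g : ↥(unitaryGroupOfForm (galAdicCompletionMap (L := L) (IsCMField.complexConj L) hw) ((StdForm.antidiagonal 3).over (w.1.adicCompletion L)))) : GL (Fin 3) (w.1.adicCompletion L)) x.1 = x.1 ∧
        x.1.map ((Matrix.toLin' ((((eA g : ↥(unitaryGroupOfForm (galAdicCompletionMap (L := L) (IsCMField.complexConj L) hw) ((StdForm.antidiagonal 3).over (w.1.adicCompletion L)))) : GL (Fin 3) (w.1.adicCompletion L)) : Matrix (Fin 3) (Fin 3) (w.1.adicCompletion L)) - 1)).restrictScalars 𝒪[(w.1.adicCompletion L)]) ≤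
          scaleLattice (ϖ ^ (e + 1)) x.1) →
      r.ρ.fixedPoints (U x₀) ≠ ⊥ :=
  exists_level_fixedPoints_ne_bot L v w hw eA hd.ϖ_ne_zero (by rw [hd.vϖ, ← WithZero.exp_zero, WithZero.exp_lt_exp]; norm_num) r x₀

/-- The same in the TAME road's letters (`hϖ : |ϖ| = q⁻¹`, any place). [cite: BernsteinZelevinsky1976, §2.1] [cite: SchneiderStuhler1997, Ch. I §2] -/
theorem exists_level_fixedPoints_ne_bot_of_v (hϖ : Valued.v ϖ = WithZero.exp (-1 : ℤ)) (r : SmoothIrrep (Gqs L v))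
    (x₀ : {M : Submodule 𝒪[(w.1.adicCompletion L)] (Fin 3 → (w.1.adicCompletion L)) // IsVertex (galAdicCompletionMap (L := L) (IsCMField.complexConj L) hw) ϖ ((StdForm.antidiagonal 3).over (w.1.adicCompletion L)) M}) :
    ∃ e₀ : ℕ, ∀ ⦃e : ℕ⦄, e₀ ≤ e → ∀ ⦃U : {M : Submodule 𝒪[(w.1.adicCompletion L)] (Fin 3 → (w.1.adicCompletion L)) // IsVertex (galAdicCompletionMap (L := L) (IsCMField.complexConj L) hw) ϖ ((StdForm.antidiagonal 3).over (w.1.adicCompletion L)) M} → Subgroup (Gqs L v)⦄,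
      (∀ x g, g ∈ U x ↔ mapGL ((eA g : ↥(unitaryGroupOfForm (galAdicCompletionMap (L := L) (IsCMField.complexConj L) hw) ((StdForm.antidiagonal 3).over (w.1.adicCompletion L)))) : GL (Fin 3) (w.1.adicCompletion L)) x.1 = x.1 ∧
        x.1.map ((Matrix.toLin' ((((eA g : ↥(unitaryGroupOfForm (galAdicCompletionMap (L := L) (IsCMField.complexConj L) hw) ((StdForm.antidiagonal 3).over (w.1.adicCompletion L)))) : GL (Fin 3) (w.1.adicCompletion L)) : Matrix (Fin 3) (Fin 3) (w.1.adicCompletion L)) - 1)).restrictScalars 𝒪[(w.1.adicCompletion L)]) ≤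
          scaleLattice (ϖ ^ (e + 1)) x.1) →
      r.ρ.fixedPoints (U x₀) ≠ ⊥ := by
  refine exists_level_fixedPoints_ne_bot L v w hw eA (fun h => ?_) (by rw [hϖ, ← WithZero.exp_zero, WithZero.exp_lt_exp]; norm_num) r x₀
  rw [h, map_zero] at hϖ
  exact WithZero.coe_ne_zero hϖ.symm

end Summit.HodgeConjecture.HodgeConjecture.Cruxes.H413.F0P3cStCharTSLevelFixedVector

end
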